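import Summits.Schanuel.Schanuel.Theorems.RootDecomp1KLocalExponent04

/-!
# RootDecomp1KLocalExponent — lens 1, generation 54, NODE 14 «THE LOCAL EXPONENT: the named targets contactC at m₀ = 2 and highContactC at m₀ = 2, 3, 4 decided hypothesis-free» (RULE K-R42 (vii′) named-target clause, K-R44, K-R45) — continuation (RootDecomp1KLocalExponent05): §9 costume tests of the members and two refused tops

(lens-1 g54 NODE 14 HOME kernel K = HOME/decomp-schanuel-lens-1/g54/LocalExponent.lean 0a24ac98…, 1537 l, 93 thm + 7 def, imports tree …RootDecomp1KHeightMachine05 ONLY (no Literature import); Probe / Ctrl0 / Ctrl + NODE-g54.md + SHA256SUMS; CLAIM L2617, crit EX-ANTE PRICE L2618 (ONE THEOREM ×1 under RULE K-R42 (vii′), NAMED-TARGET clause of L2599, iff CHECKLIST K-g54; RULE K-R45 pre-announced: local toolkit closure + frontier certificate, census instrument LIVENESS-v4), NODE L2621 / REQUEST L2622, census STAGING NOTE 4 L2623, critic VERDICT L2624: CLEARED — THEOREM ×1 under RULE K-R42 (vii′) (named-target clause), CHECKLIST K-g54 met; RULE K-R45 FIXED (local suppliers of record; LIVENESS-v4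 = frontier certificate; unconditional part DecidedAt ∨ MachineDecidedAt ∨ LocalAt); PORT GO (verbatim; docstrings / the sanctioned privatisation only). Port by census-1 gen 22 as `RootDecomp1KLocalExponent01–06` (`--supports stmt-Schanuel-33364`; no census credit): 01 = §1 helpers + §2 the three local inputs (closed range of ℚ₂ in ℂ₂ `exists_pos_le_norm_ratCast_sub`; the 2-adic LIOUVILLE inequality at a RATIONAL centre `liouville_rat`; the nearest root with its OWN multiplicity); 02 = §3 the bounded region near a root + §4 the point (∞,∞) by its NEWTON SLOPES (`dTop`, `far_slope`, `slope_arith`, `FarClause`, `SlopeCond`, `farClause_of_slopeCond`, `farClause_of_empty`); 03 = §5 THE THEOREM **`thinFibreAt_of_localAt : LocalAt m₀ P → ThinFibreAt m₀ P`** (every m₀; `rootMult`, `RootCond`, `LocalAt`, engine `thinFibreAt_of_rootCond_farClause`, spelled-out `thinFibreAt_local`) + §5b presentation independence `localAt_iff`; 04 = §6 positioning (`localAt_of_thinThreshold_le`, `localAt_of_rootlessTop(_le)`, the tree theorems re-derived) + §7 the top Y⁵ − 1 (`padic_pow_five_eq_one`, `rootCond_two_pow_five_sub_one`) + §8 the NAMED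 TARGETS **`thinFibreAt_contact_two : ThinFibreAt 2 (xPolyP 2 contactC)`**, `thinFibreAt_highContact_three` / `_four` / `_highContact'`; 05 = §9 costume tests of the members + two refused tops; 06 = §10 **`thinFibreAt_highContact_two`** (outside the class: the critical segment v₂(r) = −N!/2 is EMPTY) + §11 bookkeeping ×0 (`LocalOffAt`, residual re-graded). PORT EDITS: the two generic one-liners `norm_natCast_le_one_Cp` / `norm_intCast_le_one_Cp` PRIVATISED (head dry-run dedup.foreign notes vs Summit.ABC… / Summit.BirchSwinnertonDyer… twins; file-local copies re-emitted where used); otherwise none on declarations (K fully documented; no set_option / cite-token); provenance doc blocks + continuation headers = K's own open-lines only; statements and proofs VERBATIM. Rung 0 — nothing here proves Schanuel, 33364, 33363, 31077 or ThinFibre 2; the class `LocalAt` and the named targets are HYPOTHESIS-FREE, §11 is conditional on PadicSubspace / HeightComparison.)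
-/

noncomputable section

namespace Summit.Schanuel.Schanuel.Theorems.RootDecomp1KLocalExponent

open Polynomial LiouvilleNumber
open scoped Nat
open Summit.Schanuel.Schanuel.Theorems.RootDecomp1KTwoBaseCell (psNumer partialSum_eq_psNumer_div coprime_psNumer)
open Summit.Schanuel.Schanuel.Theorems.RootDecomp1KRelLiouvilleCell (partialSum_two_strictMono)
open Summit.Schanuel.Schanuel.Theorems.RootDecomp1KDegreeLadder
open Summit.Schanuel.Schanuel.Theorems.RootDecomp1KXLinearCore
open Summit.Schanuel.Schanuel.Theorems.RootDecomp1KXLinear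
open Summit.Schanuel.Schanuel.Theorems.RootDecomp1KXLinearII
open Summit.Schanuel.Schanuel.Theorems.RootDecomp1KXTop
open Summit.Schanuel.Schanuel.Theorems.RootDecomp1KXAll
open Summit.Schanuel.Schanuel.Theorems.RootDecomp1KLevelFinite
open Summit.Schanuel.Schanuel.Theorems.RootDecomp1KSubspaceBranch
open Summit.Schanuel.Schanuel.Theorems.RootDecomp1KHeightMachine

/-! ## §9  POSITION of the members by name (costume tests) and two REFUSED tops -/

/-- the contact member is a nonzero polynomial. -/
theorem contactP_ne_zero : xPolyP 2 contactC ≠ 0 :=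
  xPolyP_ne_zero (k := 2) (c := contactC) (by rw [contactC_two]; exact pow_five_sub_one_ne_zero)

/-- the high-contact member is a nonzero polynomial. -/
theorem highContactP_ne_zero : xPolyP 2 highContactC ≠ 0 :=
  xPolyP_ne_zero (k := 2) (c := highContactC) (by rw [highContactC_two]; exact pow_five_sub_one_ne_zero)

/-- `deg_Y (xPolyP 2 contactC) = 7`. -/
theorem natDegree_contact : (xPolyP 2 contactC).natDegree = 7 := by
  refine le_antisymm (natDegree_xPolyP_le 2 contactC 7 fun j hj => ?_) (le_natDegree_of_ne_zero ?_)
  · interval_cases j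
    · rw [natDegree_contactC_zero]
    · rw [natDegree_contactC_one]; norm_num
    · rw [natDegree_contactC_two]; norm_num
  · intro h
    have := coeff_coeff_xPolyP 2 contactC 7 0
    rw [h, coeff_zero, if_pos (Finset.mem_range.mpr (by norm_num))] at this
    have h7 : (contactC 0).coeff 7 = 1 := by
      show (X ^ 7 - 1 : ℤ[X]).coeff 7 = 1
      rw [coeff_sub, coeff_X_pow, if_pos rfl, coeff_one, if_neg (by norm_num), sub_zero]
    rw [h7] at this; exact zero_ne_one this

/-- `deg_Y (xPolyP 2 highContactC) = 9`. -/
theorem natDegree_highContact : (xPolyP 2 highContactC).natDegree = 9 := by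
  refine le_antisymm (natDegree_xPolyP_le 2 highContactC 9 fun j hj => ?_) (le_natDegree_of_ne_zero ?_)
  · interval_cases j
    · rw [natDegree_highContactC_zero]
    · rw [natDegree_highContactC_one]; norm_num
    · rw [natDegree_highContactC_two]; norm_num
  · intro h
    have := coeff_coeff_xPolyP 2 highContactC 9 0
    rw [h, coeff_zero, if_pos (Finset.mem_range.mpr (by norm_num))] at this
    have h9 : (highContactC 0).coeff 9 = 1 := by
      show (X ^ 9 - 1 : ℤ[X]).coeff 9 = 1
      rw [coeff_sub, coeff_X_pow, if_pos rfl, coeff_one, if_neg (by norm_num), sub_zero]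
    rw [h9] at this; exact zero_ne_one this

/-- `topX (xPolyP 2 contactC) = Y⁵ − 1`. -/
theorem topX_contact : topX (xPolyP 2 contactC) = X ^ 5 - 1 := topX_xPolyP 2 contactC pow_five_sub_one_ne_zero
/-- `topX (xPolyP 2 highContactC) = Y⁵ − 1`. -/
theorem topX_highContact : topX (xPolyP 2 highContactC) = X ^ 5 - 1 :=
  topX_xPolyP 2 highContactC pow_five_sub_one_ne_zero
/-- `e(contactC) = 2`. -/
theorem eTop_contact : eTop (xPolyP 2 contactC) = 2 := by
  unfold eTop; rw [topX_contact, natDegree_contact, natDegree_pow_five_sub_one]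
/-- `e(highContactC) = 4`. -/
theorem eTop_highContact : eTop (xPolyP 2 highContactC) = 4 := by
  unfold eTop; rw [topX_highContact, natDegree_highContact, natDegree_pow_five_sub_one]
/-- `μ(contactC) ≤ 1`. -/
theorem muTop_contact_le : muTop (xPolyP 2 contactC) ≤ 1 :=
  muTop_le_one_of_separable _ (by rw [topX_contact]; exact separable_pow_five_sub_one)
/-- `μ(highContactC) ≤ 1`. -/
theorem muTop_highContact_le : muTop (xPolyP 2 highContactC) ≤ 1 :=
  muTop_le_one_of_separable _ (by rw [topX_highContact]; exact separable_pow_five_sub_one)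
/-- the tree's threshold of `contactC` is EXACTLY `3` (node 5 reaches `m₀ ≥ 3`, not `2`). -/
theorem thinThreshold_contact : thinThreshold (xPolyP 2 contactC) = 3 := by
  have hμ := muTop_contact_le
  unfold thinThreshold; rw [eTop_contact]; omega
/-- the tree's threshold of `highContactC` is EXACTLY `5` (node 5 reaches `m₀ ≥ 5`, not `2, 3, 4`). -/
theorem thinThreshold_highContact : thinThreshold (xPolyP 2 highContactC) = 5 := by
  have hμ := muTop_highContact_le
  unfold thinThreshold; rw [eTop_highContact]; omega
/-- `contactC ∉ SepTopAt 2` (node 11's class, conditional on `PadicSubspace`, needs `e + 1 = 3 ≤ m₀`). -/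
theorem not_sepTopAt_two_contact : ¬ SepTopAt 2 (xPolyP 2 contactC) := fun h => by
  have := h.2; rw [eTop_contact] at this; omega
/-- (honesty) `contactC ∈ SepTopAt 3`: at `m₀ ≥ 3` the member was already decided (node 5 / node 11). -/
theorem sepTopAt_three_contact : SepTopAt 3 (xPolyP 2 contactC) :=
  ⟨by rw [topX_contact]; exact separable_pow_five_sub_one, le_of_eq (by rw [eTop_contact])⟩
/-- `highContactC ∉ SepTopAt m₀` for `m₀ ≤ 4`. -/
theorem not_sepTopAt_highContact {m₀ : ℕ} (hm : m₀ ≤ 4) : ¬ SepTopAt m₀ (xPolyP 2 highContactC) := fun h => by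
  have := h.2; rw [eTop_highContact] at this; omega
/-- (honesty) `highContactC ∈ SepTopAt 5`. -/
theorem sepTopAt_five_highContact : SepTopAt 5 (xPolyP 2 highContactC) :=
  ⟨by rw [topX_highContact]; exact separable_pow_five_sub_one, le_of_eq (by rw [eTop_highContact])⟩

/-- in EVERY presentation of `contactC` the top `x`-coefficient has the root `1 ∈ ℚ₂`: NOT `RootlessTop e`, any `e`. -/
theorem not_rootlessTop_contact (e : ℕ) : ¬ RootlessTop e (xPolyP 2 contactC) := by
  rintro ⟨k', c', -, hroot, hP⟩
  rcases top_cases_of_eq 2 contactC pow_five_sub_one_ne_zero k' c' hP with h | h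
  · exact hroot 1 (by rw [h]; show aeval (1 : ℚ_[2]) (X ^ 5 - 1 : ℤ[X]) = 0; simp)
  · exact hroot 0 (by rw [h, map_zero])
/-- the same for `highContactC`. -/
theorem not_rootlessTop_highContact (e : ℕ) : ¬ RootlessTop e (xPolyP 2 highContactC) := by
  rintro ⟨k', c', -, hroot, hP⟩
  rcases top_cases_of_eq 2 highContactC pow_five_sub_one_ne_zero k' c' hP with h | h
  · exact hroot 1 (by rw [h]; show aeval (1 : ℚ_[2]) (X ^ 5 - 1 : ℤ[X]) = 0; simp)
  · exact hroot 0 (by rw [h, map_zero])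

/-- `highContactC` is not affine in `x` (position). -/
theorem highContact_not_affine :
    bev (xPolyP 2 highContactC) 0 0 + bev (xPolyP 2 highContactC) 2 0 ≠ 2 * bev (xPolyP 2 highContactC) 1 0 := by
  simp only [bev_xPolyP, Finset.sum_range_succ, Finset.sum_range_zero, highContactC, map_sub, map_pow,
    aeval_X, map_one]
  norm_num
/-- `highContactC` is not `x`-linear (outside `XLinearLt` and the separable `x`-linear class). -/
theorem highContact_not_xLinear (A B : ℤ[X]) : xPolyP 2 highContactC ≠ xLinP A B := by
  intro h
  have := highContact_not_affine
  rw [h] at this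
  exact this (xLinP_affine A B 0)

/-- `contactC` is not a two-term curve (`x¹Y⁰` and `x²Y⁵` both occur). -/
theorem contact_ne_twoTermP (k : ℕ) (B A : ℤ[X]) : xPolyP 2 contactC ≠ twoTermP k B A := by
  intro h
  have h1 := congrArg (fun Q : ℤ[X][X] => (Q.coeff 0).coeff 1) h
  have h2 := congrArg (fun Q : ℤ[X][X] => (Q.coeff 5).coeff 2) h
  have e1 : (contactC 1).coeff 0 = 1 := by
    show (X ^ 2 + 1 : ℤ[X]).coeff 0 = 1; rw [coeff_add, coeff_X_pow, coeff_one]; norm_num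
  have e2 : (contactC 2).coeff 5 = 1 := by
    show (X ^ 5 - 1 : ℤ[X]).coeff 5 = 1; rw [coeff_sub, coeff_X_pow, coeff_one]; norm_num
  simp only [coeff_coeff_xPolyP, coeff_coeff_twoTermP, Finset.mem_range, e1, e2] at h1 h2
  split_ifs at h1 h2 <;> omega
/-- `highContactC` is not a two-term curve (`x¹Y¹` and `x²Y⁵` both occur). -/
theorem highContact_ne_twoTermP (k : ℕ) (B A : ℤ[X]) : xPolyP 2 highContactC ≠ twoTermP k B A := by
  intro h
  have h1 := congrArg (fun Q : ℤ[X][X] => (Q.coeff 1).coeff 1) h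
  have h2 := congrArg (fun Q : ℤ[X][X] => (Q.coeff 5).coeff 2) h
  have e1 : (highContactC 1).coeff 1 = 1 := by
    show (X : ℤ[X]).coeff 1 = 1; exact coeff_X_one
  have e2 : (highContactC 2).coeff 5 = 1 := by
    show (X ^ 5 - 1 : ℤ[X]).coeff 5 = 1; rw [coeff_sub, coeff_X_pow, coeff_one]; norm_num
  simp only [coeff_coeff_xPolyP, coeff_coeff_twoTermP, Finset.mem_range, e1, e2] at h1 h2
  split_ifs at h1 h2 <;> omega

/-- **`contactC` is in NO class decided at `m₀ = 2` by the tree** (each disjunct of `DecidedAt 2` refuted by name). -/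
theorem not_decidedAt_two_contact : ¬ DecidedAt 2 (xPolyP 2 contactC) := by
  rintro (h | ⟨A, B, -, -, hP⟩ | ⟨h3, -⟩ | h | h)
  · rw [natDegree_contact] at h; omega
  · exact contact_not_xLinear A B hP
  · omega
  · rw [thinThreshold_contact] at h; omega
  · exact not_rootlessTop_contact 1 h

/-- **`highContactC` is in NO class decided at `m₀ ≤ 4` by the tree.** -/
theorem not_decidedAt_highContact {m₀ : ℕ} (hm : m₀ ≤ 4) : ¬ DecidedAt m₀ (xPolyP 2 highContactC) := by
  rintro (h | ⟨A, B, -, -, hP⟩ | ⟨-, A, B, -, hP⟩ | h | h)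
  · rw [natDegree_highContact] at h; omega
  · exact highContact_not_xLinear A B hP
  · exact highContact_not_xLinear A B hP
  · rw [thinThreshold_highContact] at h; omega
  · exact not_rootlessTop_highContact _ h

/-- (c-α) the ROOT CONDITION at `m₀ = 2` REFUSES a RATIONAL DOUBLE root: `¬ RootCond 2 ((Y − 1)²)`
(branch (ii) needs `μ + 1 = 3 ≤ m₀`, branch (iii) `2μ + 1 = 5 ≤ m₀`, branch (i) fails as `1 ∈ ℚ₂`). -/
theorem not_rootCond_two_sq : ¬ RootCond 2 ((X - C 1) ^ 2 : ℤ[X]) := by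
  intro h
  have hroot : aeval (1 : PadicAlgCl 2) ((X - C 1) ^ 2 : ℤ[X]) = 0 := by simp
  have hmult : rootMult ((X - C 1) ^ 2 : ℤ[X]) 1 = 2 := by
    unfold rootMult
    rw [Polynomial.map_pow, Polynomial.map_sub, Polynomial.map_X, Polynomial.map_C, eq_intCast, Int.cast_one]
    exact rootMultiplicity_X_sub_C_pow (1 : PadicAlgCl 2) 2
  rcases h 1 hroot with hi | ⟨q, -, hii⟩ | hiii
  · exact hi 1 (map_one _)
  · rw [hmult] at hii; omega
  · rw [hmult] at hiii; omega

/-- (c-α′) but it ACCEPTS it at `m₀ = 3` (branch (ii): `2 + 1 ≤ 3`; the tree's Ridout threshold for a double root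
is `2·2 + 1 = 5`). -/
theorem rootCond_three_sq : RootCond 3 ((X - C 1) ^ 2 : ℤ[X]) := by
  intro β hβ
  have hβ1 : β = 1 := by
    have : aeval β ((X - C 1) ^ 2 : ℤ[X]) = (β - 1) ^ 2 := by simp
    rw [this] at hβ
    exact sub_eq_zero.mp (pow_eq_zero_iff (by norm_num) |>.mp hβ)
  subst hβ1
  refine Or.inr (Or.inl ⟨1, by rw [Rat.cast_one], ?_⟩)
  have hmult : rootMult ((X - C 1) ^ 2 : ℤ[X]) 1 = 2 := by
    unfold rootMult
    rw [Polynomial.map_pow, Polynomial.map_sub, Polynomial.map_X, Polynomial.map_C, eq_intCast, Int.cast_one]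
    exact rootMultiplicity_X_sub_C_pow (1 : PadicAlgCl 2) 2
  rw [hmult]

/-- (c-β) **`M17P ∉ LocalAt 2`** (the census FRONTIER member at `m₀ = 2`, `RootDecomp1KSubspaceBranch.M17P`): its top
`Y² − 17` has the IRRATIONAL SIMPLE root `√17 ∈ ℚ₂` — branch (i) fails (`√17 ∈ ℚ₂`), branch (ii) fails
(`√17 ∉ ℚ`), branch (iii) needs `3 ≤ m₀`. -/
theorem not_localAt_two_M17P : ¬ LocalAt 2 M17P := by
  intro h
  have hR := rootCond_topX_of_localAt h
  have hm2 : m17C 2 ≠ 0 := fun h0 => by have := natDegree_m17C_two; rw [h0, natDegree_zero] at this; omega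
  rw [M17P, topX_xPolyP 2 m17C hm2] at hR
  obtain ⟨z, hz⟩ := exists_padic_root_m17C_two
  have hβroot : aeval (algebraMap ℚ_[2] (PadicAlgCl 2) z) (m17C 2) = 0 := by
    rw [← algebraMap_aeval_padic, hz, map_zero]
  rcases hR _ hβroot with hi | ⟨q, hq, -⟩ | hiii
  · exact hi z rfl
  · have hq2 : (q : PadicAlgCl 2) ^ 2 = 17 := by
      have := hβroot
      rw [← hq, m17C_two, map_sub, map_pow, aeval_X, aeval_C, sub_eq_zero] at this
      rw [this, eq_intCast, Int.cast_ofNat]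
    have hq2' : (q : ℝ) ^ 2 = 17 := by
      have h' : q ^ 2 = 17 := by exact_mod_cast hq2
      exact_mod_cast congrArg (fun t : ℚ => (t : ℝ)) h'
    have hirr : Irrational (Real.sqrt (17 : ℝ)) := by
      simpa using Nat.Prime.irrational_sqrt (by norm_num : Nat.Prime 17)
    refine hirr.ne_rat |q| ?_
    rw [Rat.cast_abs, ← Real.sqrt_sq_eq_abs, hq2']
  · have hm0 : (m17C 2).map (algebraMap ℤ (PadicAlgCl 2)) ≠ 0 :=
      (Polynomial.map_ne_zero_iff (algebraMap ℤ (PadicAlgCl 2)).injective_int).mpr hm2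
    have h1 : 0 < rootMult (m17C 2) (algebraMap ℚ_[2] (PadicAlgCl 2) z) := by
      unfold rootMult
      rw [rootMultiplicity_pos hm0, IsRoot.def, eval_map_algebraMap]
      exact hβroot
    omega

end Summit.Schanuel.Schanuel.Theorems.RootDecomp1KLocalExponent

end
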